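import Summits.Ventures.CertifiedManyBodySolver.Observables.StiffnessApexTransportBandBoxes
import Summits.Ventures.CertifiedManyBodySolver.Observables.StiffnessApexTransportMottStationFan
import Summits.Ventures.CertifiedManyBodySolver.Observables.StiffnessApexTransportMirrorFanWitness
import HarnessLib

/-!
# Ventures/CertifiedManyBodySolver — Observables/StiffnessApexTransportMottMirrorFanBoxes.lean

HONEST FRAMING: one-sided certified CEILINGS on the uniform flux stiffness (t–t′ f-sum class) at HALF FILLING `n = 1` (Mott CONTROL/CALIBRATION line — `ρ_s = 0` there is print, NOT a
theorem) on WHOLE BOXES `[U_a, U_b] × [t′₁, t′₂]` with `t′ > 0`, ALL SIDES (no `Even L` / `OnMultiples`): left = g5's PH-signed MOTT STATION witness, right = g5's MIRRORED FAN witness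
(`exists_torusLimit_halfFilling_mirror_hoppingFloor`: the particle–hole image of a torus-limit ground state of the `(s, U₂, 1)` fan class lies in the `(−s, U₂, 1)` class with `K₂`
negated, so the fan's floor at hopping `−κ` is a floor at `κ` on the mirrored class — a WITNESS, which is all the apex row needs). Both members existential ⇒ g5's two-witness master
`ObsStiffnessSeqCeilingAt_of_two_apexSourceWitnesses_weighted`; the cleared word is the two-station polynomial of the companions (`…TwoStationBoxes`, `…MottFanBoxes`, same seat) with
slots `(0, −s)` and floors `(−X, α − βκ)`: QUADRATIC in `U` ⇒ `quadraticU_nonneg_on_box` ⇒ four `U`-edge quadratics per box. Every word CONDITIONAL BY NAME on the station's kinetic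
ceiling and the fan's rows; not a `T_c` / superconductivity verdict; no number of record; zero compute, no definition, no claim node, no `sorry`.

Cell `pub/hubbard-fast` (D-0154 (1)(A)), seat `hubbard-fast-reuse-2` g6 (`prover-hubbard-fast-reuse-2-g6-0`), path family «APEX TRANSPORT», line «U-AFFINE BOXES», object «MOTT × MIRROR-FAN BOXES»
(the all-sides `t′ > 0` form of the «MOTT × FAN BOXES»; by the `t′ ↦ −t′` symmetry of the construction the constants coincide with the `t′ < 0` boxes).

* §1 `ObsStiffnessSeqCeilingAt_halfFilling_of_mottStation_mirrorFan_cleared`; §2 `ObsStiffnessSeqCeilingAt_halfFilling_on_box_of_mottStation_mirrorFan`.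

References: T. Koma, H. Tasaki, J. Stat. Phys. 76 (1994) 745, §1 [KomaTasaki1994]; D. J. Scalapino, S. R. White, S.-C. Zhang, PRB 47 (1993) 7995, §II [ScalapinoWhiteZhang1993];
E. H. Lieb, F. Y. Wu, Physica A 321 (2003) 1, §1 eq. (3) [LiebWuPhysicaA2003]; E. H. Lieb, PRL 62 (1989) 1201, Theorem 2 [LiebPRL1989].
-/

noncomputable section

namespace Summit.Ventures.CertifiedManyBodySolver.Observables

open Literature.MathematicalPhysics.QuantumLattice
open Literature.MathematicalPhysics.QuantumLattice.ThermodynamicLimit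
open Literature.MathematicalPhysics.QuantumFieldTheory
open Literature.Probability.LatticeModels
open Matrix Finset Filter Topology HubbardWave0
open scoped Matrix BigOperators ComplexOrder

/-! ## §1 The cleared point master: Mott station (left, witness) × mirrored fan (right, witness), `t′ > 0` side -/

section Cleared

variable {t U U₀ U₂ s : ℝ}

/-- **MOTT STATION × MIRRORED FAN, CLEARED (n = 1).** Mott station `(0, U₀)`, `0 ≤ U₀ < U`, with kinetic ceiling `−k ≤ X` on its class; a fan class `(s, U₂, 1)`, `0 ≤ U₂ < U`, with a
universal AFFINE hopping floor `α + βκ` on `[κlo, κhi]`. With `d₁ = U − U₀`, `d₂ = U − U₂`, `K_a = U·0 − U₀t`, `K_b = U(−s) − U₂t` (the apex hopping of the MIRRORED class `(−s, U₂)`):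
range `κlo·d₂ ≤ −K_b ≤ κhi·d₂` (so the fan's floor is read at `−κ_b`), bracket `K_a ≤ 2td₁` and STRICT `2td₂ < K_b`, and the cleared word
`0 ≤ 4c(K_b d₁ − K_a d₂) + (K_b − 2td₂)(−X d₁) + (2td₁ − K_a)(α d₂ + (−β)K_b)` ⇒ `ObsStiffnessSeqCeilingAt t U 1 c` (all sides).
[cite: KomaTasaki1994, §1] [cite: ScalapinoWhiteZhang1993, §II] [cite: LiebWuPhysicaA2003, §1 eq. (3)] -/
theorem ObsStiffnessSeqCeilingAt_halfFilling_of_mottStation_mirrorFan_cleared (hU₀0 : 0 ≤ U₀) (hU₀ : U₀ < U)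
    (hU₂0 : 0 ≤ U₂) (hU₂ : U₂ < U) {α β κlo κhi X : ℝ}
    (hX : ∀ (ω : InfVolFermionState 2) (Ls : ℕ → ℕ) (ψ : ∀ L, Fock (Orb (FermionTorus 2 L))),
      Tendsto Ls atTop atTop →
      (∀ j, IsGroundStateInSector (hubbardTorusTT' (Ls j) 1 0 U₀) (rectN 1 (Ls j)) 0 (ψ (Ls j))) →
      (∀ j, star (ψ (Ls j)) ⬝ᵥ ψ (Ls j) = 1) → ω.IsTorusLimitOf ψ Ls →
      -(∑ i : Fin 2, -(1 : ℝ) * ∑ σ : Fin 2,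
          ((ω.expect {0, 0 + unitVec i}
              ((cAt 0 (mem_insert_self _ _) σ)ᴴ * cAt (0 + unitVec i) (mem_insert_of_mem (mem_singleton_self _)) σ)).re +
            (ω.expect {0, 0 + unitVec i}
              ((cAt (0 + unitVec i) (mem_insert_of_mem (mem_singleton_self _)) σ)ᴴ * cAt 0 (mem_insert_self _ _) σ)).re)) ≤ X)
    (hf : ∀ κ : ℝ, κlo ≤ κ → κ ≤ κhi →
      ∀ (ω : InfVolFermionState 2) (Ls : ℕ → ℕ) (ψ : ∀ L, Fock (Orb (FermionTorus 2 L))),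
      Tendsto Ls atTop atTop →
      (∀ j, IsGroundStateInSector (hubbardTorusTT' (Ls j) 1 s U₂) (rectN 1 (Ls j)) 0 (ψ (Ls j))) →
      (∀ j, star (ψ (Ls j)) ⬝ᵥ ψ (Ls j) = 1) → ω.IsTorusLimitOf ψ Ls →
      α + β * κ ≤ ω.meanEnergy (hubbardTTPrimeFermionInteraction 1 κ 0) 1)
    (hlob : κlo * (U - U₂) ≤ -(U * (-s) - U₂ * t)) (hhib : -(U * (-s) - U₂ * t) ≤ κhi * (U - U₂))
    (hbra : U * 0 - U₀ * t ≤ 2 * t * (U - U₀)) (hbrb : 2 * t * (U - U₂) < U * (-s) - U₂ * t) (c : ℚ)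
    (hc : 0 ≤ 4 * ((c : ℚ) : ℝ) * ((U * (-s) - U₂ * t) * (U - U₀) - (U * 0 - U₀ * t) * (U - U₂)) +
      ((U * (-s) - U₂ * t) - 2 * t * (U - U₂)) * (-X * (U - U₀)) +
      (2 * t * (U - U₀) - (U * 0 - U₀ * t)) * (α * (U - U₂) + (-β) * (U * (-s) - U₂ * t))) :
    ObsStiffnessSeqCeilingAt t U 1 c := by
  have hd₁ : 0 < U - U₀ := sub_pos.2 hU₀
  have hd₂ : 0 < U - U₂ := sub_pos.2 hU₂
  have hE : 0 < (U * (-s) - U₂ * t) * (U - U₀) - (U * 0 - U₀ * t) * (U - U₂) := by nlinarith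
  have hκa : (U * 0 - U₀ * t) / (U - U₀) * (U - U₀) = U * 0 - U₀ * t := div_mul_cancel₀ _ hd₁.ne'
  have hκb : (U * (-s) - U₂ * t) / (U - U₂) * (U - U₂) = U * (-s) - U₂ * t := div_mul_cancel₀ _ hd₂.ne'
  -- the two witnesses
  obtain ⟨ωM, LsM, ψM, hLM, hψM, h1M, hωM, hflM⟩ :=
    exists_torusLimit_halfFilling_tp0_hoppingFloor_of_negKinetic_le ((U * 0 - U₀ * t) / (U - U₀)) hX
  have hrlo : κlo ≤ -((U * (-s) - U₂ * t) / (U - U₂)) := by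
    rw [← neg_div, le_div_iff₀ hd₂]; exact hlob
  have hrhi : -((U * (-s) - U₂ * t) / (U - U₂)) ≤ κhi := by
    rw [← neg_div, div_le_iff₀ hd₂]; exact hhib
  obtain ⟨ωF, LsF, ψF, hLF, hψF, h1F, hωF, hflF⟩ :=
    exists_torusLimit_halfFilling_mirror_hoppingFloor (s := s) (U₀ := U₂) (-((U * (-s) - U₂ * t) / (U - U₂)))
      (hf _ hrlo hrhi)
  rw [neg_neg] at hflF
  refine ObsStiffnessSeqCeilingAt_of_two_apexSourceWitnesses_weighted (s₁ := 0) (U₁ := U₀) (s₂ := -s) (U₂ := U₂) (t'P := t) (UP := U)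
    (n := 1) hU₀0 hU₀ hU₂0 hU₂ zero_le_one one_lt_two
    (μ₁ := ((U * (-s) - U₂ * t) - 2 * t * (U - U₂)) * (U - U₀) / ((U * (-s) - U₂ * t) * (U - U₀) - (U * 0 - U₀ * t) * (U - U₂)))
    (μ₂ := (2 * t * (U - U₀) - (U * 0 - U₀ * t)) * (U - U₂) / ((U * (-s) - U₂ * t) * (U - U₀) - (U * 0 - U₀ * t) * (U - U₂)))
    (div_nonneg (mul_nonneg (by linarith) hd₁.le) hE.le) (div_nonneg (mul_nonneg (by linarith) hd₂.le) hE.le) ?_ ?_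
    ⟨ωM, LsM, ψM, hLM, hψM, h1M, hωM, hflM⟩ ⟨ωF, LsF, ψF, hLF, hψF, h1F, hωF, hflF⟩ c ?_
  · rw [← add_div, div_eq_one_iff_eq hE.ne']; ring
  · rw [div_mul_eq_mul_div, div_mul_eq_mul_div, ← add_div, div_eq_iff hE.ne']
    have e1 : ((U * (-s) - U₂ * t) - 2 * t * (U - U₂)) * (U - U₀) * ((U * 0 - U₀ * t) / (U - U₀)) =
        ((U * (-s) - U₂ * t) - 2 * t * (U - U₂)) * (U * 0 - U₀ * t) := by
      rw [mul_assoc, mul_comm (U - U₀), hκa]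
    have e2 : (2 * t * (U - U₀) - (U * 0 - U₀ * t)) * (U - U₂) * ((U * (-s) - U₂ * t) / (U - U₂)) =
        (2 * t * (U - U₀) - (U * 0 - U₀ * t)) * (U * (-s) - U₂ * t) := by
      rw [mul_assoc, mul_comm (U - U₂), hκb]
    rw [e1, e2]; ring
  · have eb : α + β * -((U * (-s) - U₂ * t) / (U - U₂)) = (α * (U - U₂) + (-β) * (U * (-s) - U₂ * t)) / (U - U₂) := by
      rw [eq_div_iff hd₂.ne']
      have : β * -((U * (-s) - U₂ * t) / (U - U₂)) * (U - U₂) = (-β) * (U * (-s) - U₂ * t) := by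
        rw [mul_neg, neg_mul, mul_assoc, hκb, neg_mul]
      rw [add_mul, this]
    rw [eb]
    have f1 : ((U * (-s) - U₂ * t) - 2 * t * (U - U₂)) * (U - U₀) / ((U * (-s) - U₂ * t) * (U - U₀) - (U * 0 - U₀ * t) * (U - U₂)) * (-X) =
        ((U * (-s) - U₂ * t) - 2 * t * (U - U₂)) * (-X * (U - U₀)) /
          ((U * (-s) - U₂ * t) * (U - U₀) - (U * 0 - U₀ * t) * (U - U₂)) := by
      rw [div_mul_eq_mul_div]; ring_nf
    have f2 : (2 * t * (U - U₀) - (U * 0 - U₀ * t)) * (U - U₂) / ((U * (-s) - U₂ * t) * (U - U₀) - (U * 0 - U₀ * t) * (U - U₂)) *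
        ((α * (U - U₂) + (-β) * (U * (-s) - U₂ * t)) / (U - U₂)) =
        (2 * t * (U - U₀) - (U * 0 - U₀ * t)) * (α * (U - U₂) + (-β) * (U * (-s) - U₂ * t)) /
          ((U * (-s) - U₂ * t) * (U - U₀) - (U * 0 - U₀ * t) * (U - U₂)) := by
      rw [div_mul_div_comm, mul_assoc, mul_comm (U - U₂) (α * (U - U₂) + (-β) * (U * (-s) - U₂ * t)), ← mul_assoc,
        mul_div_mul_right _ _ hd₂.ne']
    rw [f1, f2, ← add_div]
    have hN : -(4 * ((c : ℚ) : ℝ)) * ((U * (-s) - U₂ * t) * (U - U₀) - (U * 0 - U₀ * t) * (U - U₂)) ≤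
        ((U * (-s) - U₂ * t) - 2 * t * (U - U₂)) * (-X * (U - U₀)) +
          (2 * t * (U - U₀) - (U * 0 - U₀ * t)) * (α * (U - U₂) + (-β) * (U * (-s) - U₂ * t)) := by
      nlinarith [hc]
    have hNE := (le_div_iff₀ hE).2 hN
    linarith

end Cleared

/-! ## §2 THE MOTT × MIRROR-FAN BOX THEOREM (n = 1, t′ > 0, all sides) -/

section Box

variable {U₀ U₂ s : ℝ}

/-- **MOTT × MIRROR-FAN BOX WORD (n = 1, `t′ > 0`, all sides).** Station `(0,U₀)` with kinetic ceiling `X`; fan class `(s, U₂, 1)` with a universal affine floor on `[κlo, κhi]`; a box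
`max(U₀,U₂) < U_a < U_b`, `t₁ < t₂`; at the four corners: `κlo·d₂ ≤ −K_b ≤ κhi·d₂`, `K_a ≤ 2td₁`, STRICT `2td₂ < K_b`; on the two `U`-edges, for every `t ∈ [t₁,t₂]`: `0 ≤ P(U_e,t)` and
`0 ≤ P(U_e,t) − q(t)(U_b−U_a)²/4` with `q(t) = 4c(−s − 0) + (−s − 2t)(−X + 0·0) + (2t − 0)(α + (−β)(−s))`. Then `ObsStiffnessSeqCeilingAt t U 1 c` at EVERY point of the box.
[cite: KomaTasaki1994, §1] [cite: ScalapinoWhiteZhang1993, §II] [cite: LiebWuPhysicaA2003, §1 eq. (3)] -/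
theorem ObsStiffnessSeqCeilingAt_halfFilling_on_box_of_mottStation_mirrorFan (hU₀0 : 0 ≤ U₀) (hU₂0 : 0 ≤ U₂) {α β κlo κhi X : ℝ}
    (hX : ∀ (ω : InfVolFermionState 2) (Ls : ℕ → ℕ) (ψ : ∀ L, Fock (Orb (FermionTorus 2 L))),
      Tendsto Ls atTop atTop →
      (∀ j, IsGroundStateInSector (hubbardTorusTT' (Ls j) 1 0 U₀) (rectN 1 (Ls j)) 0 (ψ (Ls j))) →
      (∀ j, star (ψ (Ls j)) ⬝ᵥ ψ (Ls j) = 1) → ω.IsTorusLimitOf ψ Ls →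
      -(∑ i : Fin 2, -(1 : ℝ) * ∑ σ : Fin 2,
          ((ω.expect {0, 0 + unitVec i}
              ((cAt 0 (mem_insert_self _ _) σ)ᴴ * cAt (0 + unitVec i) (mem_insert_of_mem (mem_singleton_self _)) σ)).re +
            (ω.expect {0, 0 + unitVec i}
              ((cAt (0 + unitVec i) (mem_insert_of_mem (mem_singleton_self _)) σ)ᴴ * cAt 0 (mem_insert_self _ _) σ)).re)) ≤ X)
    (hf : ∀ κ : ℝ, κlo ≤ κ → κ ≤ κhi →
      ∀ (ω : InfVolFermionState 2) (Ls : ℕ → ℕ) (ψ : ∀ L, Fock (Orb (FermionTorus 2 L))),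
      Tendsto Ls atTop atTop →
      (∀ j, IsGroundStateInSector (hubbardTorusTT' (Ls j) 1 s U₂) (rectN 1 (Ls j)) 0 (ψ (Ls j))) →
      (∀ j, star (ψ (Ls j)) ⬝ᵥ ψ (Ls j) = 1) → ω.IsTorusLimitOf ψ Ls →
      α + β * κ ≤ ω.meanEnergy (hubbardTTPrimeFermionInteraction 1 κ 0) 1)
    {Ua Ub t₁ t₂ : ℝ} (hUa₁ : U₀ < Ua) (hUa₂ : U₂ < Ua) (hab : Ua < Ub) (h12 : t₁ < t₂)
    (hlob₁ : κlo * (Ua - U₂) ≤ -(Ua * (-s) - U₂ * t₁)) (hlob₂ : κlo * (Ua - U₂) ≤ -(Ua * (-s) - U₂ * t₂))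
    (hlob₃ : κlo * (Ub - U₂) ≤ -(Ub * (-s) - U₂ * t₁)) (hlob₄ : κlo * (Ub - U₂) ≤ -(Ub * (-s) - U₂ * t₂))
    (hhib₁ : -(Ua * (-s) - U₂ * t₁) ≤ κhi * (Ua - U₂)) (hhib₂ : -(Ua * (-s) - U₂ * t₂) ≤ κhi * (Ua - U₂))
    (hhib₃ : -(Ub * (-s) - U₂ * t₁) ≤ κhi * (Ub - U₂)) (hhib₄ : -(Ub * (-s) - U₂ * t₂) ≤ κhi * (Ub - U₂))
    (hbra₁ : Ua * 0 - U₀ * t₁ ≤ 2 * t₁ * (Ua - U₀)) (hbra₂ : Ua * 0 - U₀ * t₂ ≤ 2 * t₂ * (Ua - U₀))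
    (hbra₃ : Ub * 0 - U₀ * t₁ ≤ 2 * t₁ * (Ub - U₀)) (hbra₄ : Ub * 0 - U₀ * t₂ ≤ 2 * t₂ * (Ub - U₀))
    (hbrb₁ : 2 * t₁ * (Ua - U₂) < Ua * (-s) - U₂ * t₁) (hbrb₂ : 2 * t₂ * (Ua - U₂) < Ua * (-s) - U₂ * t₂)
    (hbrb₃ : 2 * t₁ * (Ub - U₂) < Ub * (-s) - U₂ * t₁) (hbrb₄ : 2 * t₂ * (Ub - U₂) < Ub * (-s) - U₂ * t₂) (c : ℚ)
    (hPa : ∀ t ∈ Set.Icc t₁ t₂, 0 ≤ 4 * ((c : ℚ) : ℝ) * ((Ua * (-s) - U₂ * t) * (Ua - U₀) - (Ua * 0 - U₀ * t) * (Ua - U₂)) +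
      ((Ua * (-s) - U₂ * t) - 2 * t * (Ua - U₂)) * (-X * (Ua - U₀)) +
      (2 * t * (Ua - U₀) - (Ua * 0 - U₀ * t)) * (α * (Ua - U₂) + (-β) * (Ua * (-s) - U₂ * t)))
    (hPb : ∀ t ∈ Set.Icc t₁ t₂, 0 ≤ 4 * ((c : ℚ) : ℝ) * ((Ub * (-s) - U₂ * t) * (Ub - U₀) - (Ub * 0 - U₀ * t) * (Ub - U₂)) +
      ((Ub * (-s) - U₂ * t) - 2 * t * (Ub - U₂)) * (-X * (Ub - U₀)) +
      (2 * t * (Ub - U₀) - (Ub * 0 - U₀ * t)) * (α * (Ub - U₂) + (-β) * (Ub * (-s) - U₂ * t)))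
    (hPaW : ∀ t ∈ Set.Icc t₁ t₂, 0 ≤ 4 * ((c : ℚ) : ℝ) * ((Ua * (-s) - U₂ * t) * (Ua - U₀) - (Ua * 0 - U₀ * t) * (Ua - U₂)) +
      ((Ua * (-s) - U₂ * t) - 2 * t * (Ua - U₂)) * (-X * (Ua - U₀)) +
      (2 * t * (Ua - U₀) - (Ua * 0 - U₀ * t)) * (α * (Ua - U₂) + (-β) * (Ua * (-s) - U₂ * t)) -
      (4 * ((c : ℚ) : ℝ) * ((-s) - 0) + ((-s) - 2 * t) * (-X + 0 * 0) + (2 * t - 0) * (α + (-β) * (-s))) * ((Ub - Ua) ^ 2 / 4))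
    (hPbW : ∀ t ∈ Set.Icc t₁ t₂, 0 ≤ 4 * ((c : ℚ) : ℝ) * ((Ub * (-s) - U₂ * t) * (Ub - U₀) - (Ub * 0 - U₀ * t) * (Ub - U₂)) +
      ((Ub * (-s) - U₂ * t) - 2 * t * (Ub - U₂)) * (-X * (Ub - U₀)) +
      (2 * t * (Ub - U₀) - (Ub * 0 - U₀ * t)) * (α * (Ub - U₂) + (-β) * (Ub * (-s) - U₂ * t)) -
      (4 * ((c : ℚ) : ℝ) * ((-s) - 0) + ((-s) - 2 * t) * (-X + 0 * 0) + (2 * t - 0) * (α + (-β) * (-s))) * ((Ub - Ua) ^ 2 / 4)) :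
    ∀ U ∈ Set.Icc Ua Ub, ∀ t ∈ Set.Icc t₁ t₂, ObsStiffnessSeqCeilingAt t U 1 c := by
  intro U hU t ht
  have hU₀lt : U₀ < U := hUa₁.trans_le hU.1
  have hU₂lt : U₂ < U := hUa₂.trans_le hU.1
  have hlob : κlo * (U - U₂) ≤ -(U * (-s) - U₂ * t) := by
    have h := bilinear_nonneg_on_box (a := κlo * U₂) (b := s - κlo) (c := U₂) (d := 0) hab h12 hU ht
      (by linarith only [hlob₁]) (by linarith only [hlob₂]) (by linarith only [hlob₃]) (by linarith only [hlob₄])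
    linarith only [h]
  have hhib : -(U * (-s) - U₂ * t) ≤ κhi * (U - U₂) := by
    have h := bilinear_nonneg_on_box (a := -(κhi * U₂)) (b := κhi - s) (c := -U₂) (d := 0) hab h12 hU ht
      (by linarith only [hhib₁]) (by linarith only [hhib₂]) (by linarith only [hhib₃]) (by linarith only [hhib₄])
    linarith only [h]
  have hbra : U * 0 - U₀ * t ≤ 2 * t * (U - U₀) := by
    have h := bilinear_nonneg_on_box (a := 0) (b := 0) (c := -U₀) (d := 2) hab h12 hU ht
      (by linarith only [hbra₁]) (by linarith only [hbra₂]) (by linarith only [hbra₃]) (by linarith only [hbra₄])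
    linarith only [h]
  have hbrb : 2 * t * (U - U₂) < U * (-s) - U₂ * t := by
    set m := min (min ((Ua * (-s) - U₂ * t₁) - 2 * t₁ * (Ua - U₂)) ((Ua * (-s) - U₂ * t₂) - 2 * t₂ * (Ua - U₂)))
        (min ((Ub * (-s) - U₂ * t₁) - 2 * t₁ * (Ub - U₂)) ((Ub * (-s) - U₂ * t₂) - 2 * t₂ * (Ub - U₂))) with hm_def
    have hm : 0 < m :=
      lt_min (lt_min (by linarith only [hbrb₁]) (by linarith only [hbrb₂])) (lt_min (by linarith only [hbrb₃]) (by linarith only [hbrb₄]))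
    have h1 : m ≤ (Ua * (-s) - U₂ * t₁) - 2 * t₁ * (Ua - U₂) := (min_le_left _ _).trans (min_le_left _ _)
    have h2 : m ≤ (Ua * (-s) - U₂ * t₂) - 2 * t₂ * (Ua - U₂) := (min_le_left _ _).trans (min_le_right _ _)
    have h3 : m ≤ (Ub * (-s) - U₂ * t₁) - 2 * t₁ * (Ub - U₂) := (min_le_right _ _).trans (min_le_left _ _)
    have h4 : m ≤ (Ub * (-s) - U₂ * t₂) - 2 * t₂ * (Ub - U₂) := (min_le_right _ _).trans (min_le_right _ _)
    have h := bilinear_nonneg_on_box (a := -m) (b := -s) (c := U₂) (d := -2) hab h12 hU ht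
      (by linarith only [h1]) (by linarith only [h2]) (by linarith only [h3]) (by linarith only [h4])
    linarith only [h, hm]
  refine ObsStiffnessSeqCeilingAt_halfFilling_of_mottStation_mirrorFan_cleared hU₀0 hU₀lt hU₂0 hU₂lt hX hf hlob hhib hbra hbrb c ?_
  have h := quadraticU_nonneg_on_box (U := U)
    (q := (4 * ((c : ℚ) : ℝ) * ((-s) - 0) + ((-s) - 2 * t) * (-X + 0 * 0) + (2 * t - 0) * (α + (-β) * (-s))))
    (p := 4 * ((c : ℚ) : ℝ) * (-(U₂ * t) - (-s) * U₀ + U₀ * t + 0 * U₂) + ((-s) - 2 * t) * (-(-X * U₀) - 0 * U₀ * t) +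
      (-(U₂ * t) + 2 * t * U₂) * (-X + 0 * 0) + (2 * t - 0) * (-(α * U₂) - (-β) * U₂ * t) + (-(2 * t * U₀) + U₀ * t) * (α + (-β) * (-s)))
    (r := 4 * ((c : ℚ) : ℝ) * (U₂ * t * U₀ - U₀ * t * U₂) + (-(U₂ * t) + 2 * t * U₂) * (-(-X * U₀) - 0 * U₀ * t) +
      (-(2 * t * U₀) + U₀ * t) * (-(α * U₂) - (-β) * U₂ * t))
    hab hU (by convert hPa t ht using 1; ring) (by convert hPb t ht using 1; ring)
    (by convert hPaW t ht using 1; ring) (by convert hPbW t ht using 1; ring)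
  convert h using 1
  ring

end Box

end Summit.Ventures.CertifiedManyBodySolver.Observables

end
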